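import Literature.Probability.Percolation.RegionGluing
import HarnessLib

/-!
# Sparse gluing: two non-percolating regions joined along a Borel–Cantelli-sparse seam

Topic: `Literature/Probability/Percolation`.  The probabilistic form of the deterministic two-region
criterion `RegionGluing.finite_openClusterIn_union`.  Let `A`, `B` be disjoint vertex sets of a graph
`G` whose cross edges have unique mates on both sides (every `A`-vertex has at most one
`B`-neighbour and conversely).  If, `P_p`-almost surely, every open cluster computed inside `A` and
every open cluster computed inside `B` is finite, and the `A`-endpoints of the cross edges have
SUMMABLE pairwise connection probabilities inside `A`, then `P_p`-almost surely every open cluster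
computed inside `A ∪ B` is finite (`ae_finite_openClusterIn_union`); in `θ`-language,
`θ_{G[A ∪ B]}(x, p) = 0` at every root (`theta_induce_union_eq_zero`).  Proof: first Borel–Cantelli
lemma (`MeasureTheory.ae_finite_setOf_mem`) — only finitely many pairs of cross-edge endpoints are
joined inside `A` — and the deterministic criterion.

This is the engine behind the sparse-fin, perforated-wall and square-fin theorems of the
CriticalPhenomena programme (`Summits/CriticalPhenomena/PercolationContinuityZ3/Theorems/SoloBlind*`),
stated once over an arbitrary countable graph so that other seams (slabs, wedges, other lattices)
can reuse it.  Elementary; no source beyond the Borel–Cantelli lemma (Grimmett 1999, §1.6 uses the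
same "sparse defects are harmless" reasoning informally).
-/

noncomputable section

namespace Literature.Probability.Percolation.SparseGluing

open MeasureTheory Literature.Probability.Percolation Literature.Probability.LatticeModels
open Literature.Probability.Percolation.RegionGluing

variable {V : Type*} [Countable V] {G : SimpleGraph V} {p : unitInterval}

/-- **Sparse gluing, almost surely.** Disjoint `A`, `B` with unique-mate cross edges; a.s. all
`A`-clusters and all `B`-clusters finite; the `A`-endpoints of cross edges have summable pairwise
connection probabilities inside `A`.  Then a.s. every open cluster computed inside `A ∪ B` is
finite. [folklore] -/
theorem ae_finite_openClusterIn_union {A B : Set V} (hAB : Disjoint A B)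
    (hmate₁ : ∀ ⦃u v v' : V⦄, u ∈ A → v ∈ B → v' ∈ B → G.Adj u v → G.Adj u v' → v = v')
    (hmate₂ : ∀ ⦃u u' v : V⦄, u ∈ A → u' ∈ A → v ∈ B → G.Adj u v → G.Adj u' v → u = u')
    (hfinA : ∀ᵐ ω ∂(bondPercolation G p), ∀ u, (openClusterIn (withinGraph G A) ω u).Finite)
    (hfinB : ∀ᵐ ω ∂(bondPercolation G p), ∀ v, (openClusterIn (withinGraph G B) ω v).Finite)
    (hsum : ∑' q : {q : V × V // (q.1 ∈ A ∧ ∃ v ∈ B, G.Adj q.1 v) ∧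
        (q.2 ∈ A ∧ ∃ v ∈ B, G.Adj q.2 v) ∧ q.1 ≠ q.2},
        (bondPercolation G p) (openConnVia (withinGraph G A) q.1.1 q.1.2) ≠ ⊤) :
    ∀ᵐ ω ∂(bondPercolation G p), ∀ x, (openClusterIn (withinGraph G (A ∪ B)) ω x).Finite := by
  classical
  filter_upwards [hfinA, hfinB, MeasureTheory.ae_finite_setOf_mem hsum] with ω hA hB hfin x
  refine finite_openClusterIn_union hAB hmate₁ hmate₂ hA hB ?_ x
  -- the doubly-connected cross edges inject into the finitely many occurring pairs
  refine (hfin.image fun q : {q : V × V // (q.1 ∈ A ∧ ∃ v ∈ B, G.Adj q.1 v) ∧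
      (q.2 ∈ A ∧ ∃ v ∈ B, G.Adj q.2 v) ∧ q.1 ≠ q.2} =>
        ((q.1.1, Classical.choose q.2.1.2) : V × V)).subset ?_
  rintro e ⟨he, e', he', hne, hconn⟩
  have hne1 : e.1 ≠ e'.1 := by
    intro h
    apply hne
    have hadj : G.Adj e.1 e'.2 := by rw [h]; exact he'.2.2
    exact Prod.ext h.symm (hmate₁ he.1 he'.2.1 he.2.1 hadj he.2.2)
  refine ⟨⟨(e.1, e'.1), ⟨he.1, e.2, he.2.1, he.2.2⟩, ⟨he'.1, e'.2, he'.2.1, he'.2.2⟩, hne1⟩,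
    ?_, ?_⟩
  · show e'.1 ∈ openClusterIn (withinGraph G A) ω e.1
    exact hconn
  · have hspec := Classical.choose_spec
      (show ∃ v ∈ B, G.Adj e.1 v from ⟨e.2, he.2.1, he.2.2⟩)
    exact Prod.ext rfl (hmate₁ he.1 hspec.1 he.2.1 hspec.2 he.2.2)

/-- **Sparse gluing, `θ`-form.** Under the hypotheses of `ae_finite_openClusterIn_union`,
`θ_{G[A ∪ B]}(x, p) = 0` at every root `x ∈ A ∪ B`. [folklore] -/
theorem theta_induce_union_eq_zero {A B : Set V} (hAB : Disjoint A B)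
    (hmate₁ : ∀ ⦃u v v' : V⦄, u ∈ A → v ∈ B → v' ∈ B → G.Adj u v → G.Adj u v' → v = v')
    (hmate₂ : ∀ ⦃u u' v : V⦄, u ∈ A → u' ∈ A → v ∈ B → G.Adj u v → G.Adj u' v → u = u')
    (hfinA : ∀ᵐ ω ∂(bondPercolation G p), ∀ u, (openClusterIn (withinGraph G A) ω u).Finite)
    (hfinB : ∀ᵐ ω ∂(bondPercolation G p), ∀ v, (openClusterIn (withinGraph G B) ω v).Finite)
    (hsum : ∑' q : {q : V × V // (q.1 ∈ A ∧ ∃ v ∈ B, G.Adj q.1 v) ∧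
        (q.2 ∈ A ∧ ∃ v ∈ B, G.Adj q.2 v) ∧ q.1 ≠ q.2},
        (bondPercolation G p) (openConnVia (withinGraph G A) q.1.1 q.1.2) ≠ ⊤)
    (x : V) (hx : x ∈ A ∪ B) : theta (G.induce (A ∪ B)) ⟨x, hx⟩ p = 0 := by
  rw [theta_induce_eq_real_percolatesVia]
  refine (measureReal_eq_zero_iff (measure_ne_top _ _)).2 (measure_eq_zero_iff_ae_notMem.2 ?_)
  filter_upwards [ae_finite_openClusterIn_union hAB hmate₁ hmate₂ hfinA hfinB hsum] with ω hω
  exact fun hperc => hperc (hω x)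

/-- **The percolating side may be swapped**: the summability hypothesis can be placed on the
`B`-endpoints of the cross edges instead (apply `ae_finite_openClusterIn_union` with the roles of
`A` and `B` exchanged; `A ∪ B = B ∪ A`). [folklore] -/
theorem ae_finite_openClusterIn_union_right {A B : Set V} (hAB : Disjoint A B)
    (hmate₁ : ∀ ⦃u v v' : V⦄, u ∈ A → v ∈ B → v' ∈ B → G.Adj u v → G.Adj u v' → v = v')
    (hmate₂ : ∀ ⦃u u' v : V⦄, u ∈ A → u' ∈ A → v ∈ B → G.Adj u v → G.Adj u' v → u = u')
    (hfinA : ∀ᵐ ω ∂(bondPercolation G p), ∀ u, (openClusterIn (withinGraph G A) ω u).Finite)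
    (hfinB : ∀ᵐ ω ∂(bondPercolation G p), ∀ v, (openClusterIn (withinGraph G B) ω v).Finite)
    (hsum : ∑' q : {q : V × V // (q.1 ∈ B ∧ ∃ u ∈ A, G.Adj q.1 u) ∧
        (q.2 ∈ B ∧ ∃ u ∈ A, G.Adj q.2 u) ∧ q.1 ≠ q.2},
        (bondPercolation G p) (openConnVia (withinGraph G B) q.1.1 q.1.2) ≠ ⊤) :
    ∀ᵐ ω ∂(bondPercolation G p), ∀ x, (openClusterIn (withinGraph G (A ∪ B)) ω x).Finite := by
  have h := ae_finite_openClusterIn_union (G := G) (p := p) hAB.symm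
    (fun u v v' hu hv hv' huv huv' => hmate₂ hv hv' hu huv.symm huv'.symm)
    (fun u u' v hu hu' hv huv hu'v => hmate₁ hv hu hu' huv.symm hu'v.symm) hfinB hfinA hsum
  simpa only [Set.union_comm] using h

end Literature.Probability.Percolation.SparseGluing
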